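import Mathlib.Algebra.Homology.DerivedCategory.Ext.ExactSequences
import Mathlib.Algebra.Homology.ShortComplex.ModuleCat
import Mathlib.CategoryTheory.Abelian.Projective.Dimension
import Mathlib.Algebra.Category.ModuleCat.Projective
import Mathlib.Algebra.Category.ModuleCat.Ext.HasExt
import HarnessLib

/-!
# `Ext¹(X₃, N) = 0` iff morphisms out of the subobject `X₁` extend over `X₂`
# (algebraic half of G2 (vii) = (W) of chain W4.4)

`[OURS · L W4.4]` Crux `HomologicalConductor.NoZenoR` (stmt-ResolutionOfSingularities-19943; twin
`NoZeno` stmt-ResolutionOfSingularities-16483), line `sandwich-cluster`, S3 Layer 2, G-layer item **G2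
(full-sheaf package), clause (vii) = (W): `Ext¹_T(M, T) = 0 ⇒ H¹(X, M̃^∨) = 0`** (res-L0-w44-plan-1
CRUX-PLAN v6 §B; res-L0-w44-idea-1 THEOREM Q-rat §3 (B4)).  In the (B4) rendering
`H¹(ℳ^∨) = coker (T^μ → H⁰(𝒦^∨)) ↪ coker ((T^μ)* → (ΩM)*)`, and the right-hand cokernel vanishes as
soon as every functional on the first syzygy `ΩM = ker (T^μ ↠ M)` extends to `T^μ`; that extension
property is what `Ext¹_T(M, T) = 0` (the output of the CA-layer target CA2, Iyama–Wemyss 2.7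
(e)⇒(d)) MEANS.  This file is that dictionary, vocabulary-free:

* `exists_comp_eq_of_forall_ext_one_eq_zero` — in any abelian category with `Ext`: for a short exact
  `0 → X₁ —f→ X₂ → X₃ → 0` and an object `N` with `Ext¹(X₃, N) = 0`, every `φ : X₁ ⟶ N` extends
  over `f` (`∃ ψ : X₂ ⟶ N, f ≫ ψ = φ`);
* `ext_one_eq_zero_of_forall_exists_comp_eq` — conversely, if `Ext¹(X₂, N) = 0` (e.g. `X₂`
  projective) and every `X₁ ⟶ N` extends over `f`, then `Ext¹(X₃, N) = 0`;
* `forall_ext_one_eq_zero_iff_forall_exists_comp_eq` — the equivalence for `X₂` projective;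
* `exists_linearMap_comp_subtype_eq_of_forall_ext_one_eq_zero` — ModuleCat corollary: for a
  surjective linear map `f : P → M` and a module `N` with `Ext¹(M, N) = 0` (Mathlib `Ext` in
  `ModuleCat`), every linear map `ker f → N` is the restriction of a linear map `P → N`;
* `dualMap_subtype_surjective_of_forall_ext_one_eq_zero` — the case `N = T`: `Ext¹(M, T) = 0` makes
  the restriction `Dual P → Dual (ker f)` SURJECTIVE.

Folklore (the long exact `Hom(X₂, N) → Hom(X₁, N) → Ext¹(X₃, N) → Ext¹(X₂, N)`); replaces the role
of no printed item of the manuscript under review (Hironaka 2017); AI-written, weaker than expert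
review. [cite: BrunsHerzog1998, §1.2 (folklore)]; [cite: IyamaWemyss2009, Thm. 2.7]
-/

-- single-problem summit: the doubled namespace component `ResolutionOfSingularities` is forced
set_option linter.dupNamespace false

noncomputable section

open CategoryTheory CategoryTheory.Abelian

universe w v u

namespace Summit.ResolutionOfSingularities.ResolutionOfSingularities.Theorems.NoZeno.SandwichCluster

section Abelian

variable {C : Type u} [Category.{v} C] [Abelian C] [HasExt.{w} C]

/-- **Extension over a subobject from `Ext¹ = 0`.**  For a short exact sequence
`0 → X₁ —f→ X₂ —g→ X₃ → 0` and an object `N` with `Ext¹(X₃, N) = 0`, every morphism `φ : X₁ ⟶ N`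
extends over `f`: exactness of `Hom(X₂, N) → Hom(X₁, N) —δ→ Ext¹(X₃, N)` (Mathlib
`Ext.contravariant_sequence_exact₁` in degree `0`). [cite: BrunsHerzog1998, §1.2 (folklore)] -/
theorem exists_comp_eq_of_forall_ext_one_eq_zero {S : ShortComplex C} (hS : S.ShortExact) {N : C}
    (h : ∀ e : Ext S.X₃ N 1, e = 0) (φ : S.X₁ ⟶ N) : ∃ ψ : S.X₂ ⟶ N, S.f ≫ ψ = φ := by
  have hδ : hS.extClass.comp (Ext.mk₀ φ) (add_zero 1) = 0 := h _
  obtain ⟨y, hy⟩ := Ext.contravariant_sequence_exact₁ hS N (Ext.mk₀ φ) (add_zero 1) hδ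
  obtain ⟨ψ, rfl⟩ := (Ext.mk₀_bijective _ _).2 y
  refine ⟨ψ, (Ext.mk₀_bijective _ _).1 ?_⟩
  rw [← Ext.mk₀_comp_mk₀]
  exact hy

/-- **`Ext¹ = 0` from the extension property.**  For a short exact `0 → X₁ —f→ X₂ —g→ X₃ → 0` with
`Ext¹(X₂, N) = 0` (e.g. `X₂` projective): if every `φ : X₁ ⟶ N` extends over `f`, then
`Ext¹(X₃, N) = 0` — exactness of `Hom(X₁, N) —δ→ Ext¹(X₃, N) → Ext¹(X₂, N)` and `δ (f ≫ ψ) = 0`.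
[cite: BrunsHerzog1998, §1.2 (folklore)] -/
theorem ext_one_eq_zero_of_forall_exists_comp_eq {S : ShortComplex C} (hS : S.ShortExact) {N : C}
    (h₂ : ∀ e : Ext S.X₂ N 1, e = 0) (h : ∀ φ : S.X₁ ⟶ N, ∃ ψ : S.X₂ ⟶ N, S.f ≫ ψ = φ)
    (e : Ext S.X₃ N 1) : e = 0 := by
  have h0 : (Ext.mk₀ S.g).comp e (zero_add 1) = 0 := h₂ _
  obtain ⟨x₁, rfl⟩ := Ext.contravariant_sequence_exact₃ hS N e h0 (add_zero 1)
  obtain ⟨φ, rfl⟩ := (Ext.mk₀_bijective _ _).2 x₁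
  obtain ⟨ψ, hψ⟩ := h φ
  rw [← hψ, ← Ext.mk₀_comp_mk₀]
  exact hS.extClass_comp_assoc (Ext.mk₀ ψ)

/-- For `X₂` PROJECTIVE: `Ext¹(X₃, N) = 0` iff every morphism `X₁ ⟶ N` extends over `f`.
[cite: BrunsHerzog1998, §1.2 (folklore)] -/
theorem forall_ext_one_eq_zero_iff_forall_exists_comp_eq {S : ShortComplex C} (hS : S.ShortExact)
    [Projective S.X₂] (N : C) :
    (∀ e : Ext S.X₃ N 1, e = 0) ↔ ∀ φ : S.X₁ ⟶ N, ∃ ψ : S.X₂ ⟶ N, S.f ≫ ψ = φ :=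
  ⟨fun h φ => exists_comp_eq_of_forall_ext_one_eq_zero hS h φ,
    fun h e => ext_one_eq_zero_of_forall_exists_comp_eq hS
      (fun e' => e'.eq_zero_of_hasProjectiveDimensionLT 1 (le_refl 1)) h e⟩

end Abelian

/-! ## Modules: functionals on a first syzygy extend -/

section ModuleCat

variable {T : Type u} [CommRing T]

/-- **Module form.**  For a surjective linear map `f : P → M` and a module `N` with
`Ext¹(M, N) = 0` (Mathlib's `Ext` in `ModuleCat`, on `ModuleCat.of T M`), every linear map
`ker f → N` is the restriction of a linear map `P → N`. [cite: BrunsHerzog1998, §1.2 (folklore)] -/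
theorem exists_linearMap_comp_subtype_eq_of_forall_ext_one_eq_zero
    {P M N : Type u} [AddCommGroup P] [Module T P] [AddCommGroup M] [Module T M]
    [AddCommGroup N] [Module T N] {f : P →ₗ[T] M} (hf : Function.Surjective f)
    (h : ∀ e : Ext (ModuleCat.of T M) (ModuleCat.of T N) 1, e = 0) (φ : LinearMap.ker f →ₗ[T] N) :
    ∃ ψ : P →ₗ[T] N, ψ ∘ₗ (LinearMap.ker f).subtype = φ := by
  obtain ⟨ψ, hψ⟩ := exists_comp_eq_of_forall_ext_one_eq_zero
    (LinearMap.shortExact_shortComplexKer hf) (N := ModuleCat.of T N) h (ModuleCat.ofHom φ)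
  refine ⟨ψ.hom, ?_⟩
  have := congrArg ModuleCat.Hom.hom hψ
  simpa [ModuleCat.hom_comp] using this

/-- **Duals.**  For a surjective linear map `f : P → M` with `Ext¹(M, T) = 0`, restriction of
functionals `Dual T P → Dual T (ker f)` is SURJECTIVE — the form in which THEOREM Q-rat (B4) consumes
the Iyama–Wemyss vanishing `Ext¹_T(L*, T) = 0` (CA-layer CA2): `coker ((T^μ)* → (ΩM)*) = 0`.
[cite: IyamaWemyss2009, Thm. 2.7]; [cite: BrunsHerzog1998, §1.2 (folklore)] -/
theorem dualMap_subtype_surjective_of_forall_ext_one_eq_zero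
    {P M : Type u} [AddCommGroup P] [Module T P] [AddCommGroup M] [Module T M]
    {f : P →ₗ[T] M} (hf : Function.Surjective f)
    (h : ∀ e : Ext (ModuleCat.of T M) (ModuleCat.of T T) 1, e = 0) :
    Function.Surjective (LinearMap.ker f).subtype.dualMap := by
  intro φ
  obtain ⟨ψ, hψ⟩ := exists_linearMap_comp_subtype_eq_of_forall_ext_one_eq_zero hf h φ
  exact ⟨ψ, by rw [LinearMap.dualMap_apply', hψ]⟩

/-- Conversely, for `P` PROJECTIVE and `f : P → M` surjective: if every functional on `ker f`
extends to `P`, then `Ext¹(M, T) = 0`. [cite: BrunsHerzog1998, §1.2 (folklore)] -/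
theorem ext_one_eq_zero_of_dualMap_subtype_surjective
    {P M : Type u} [AddCommGroup P] [Module T P] [Module.Projective T P] [AddCommGroup M]
    [Module T M] {f : P →ₗ[T] M} (hf : Function.Surjective f)
    (h : Function.Surjective (LinearMap.ker f).subtype.dualMap)
    (e : Ext (ModuleCat.of T M) (ModuleCat.of T T) 1) : e = 0 := by
  have hP : Projective (ModuleCat.of T P) := inferInstance
  refine ext_one_eq_zero_of_forall_exists_comp_eq (LinearMap.shortExact_shortComplexKer hf)
    (fun e' => e'.eq_zero_of_hasProjectiveDimensionLT 1 (le_refl 1)) (fun φ => ?_) e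
  obtain ⟨ψ, hψ⟩ := h φ.hom
  refine ⟨ModuleCat.ofHom ψ, ?_⟩
  ext x
  have := LinearMap.congr_fun hψ x
  simpa [LinearMap.dualMap_apply'] using this

end ModuleCat

end Summit.ResolutionOfSingularities.ResolutionOfSingularities.Theorems.NoZeno.SandwichCluster

end
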